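import Summits.HodgeConjecture.CorCM.AbelianSixteenStabilisersB
import Literature.AlgebraicGeometry.Pohlmann1968.NondegenerateCMTypeHodgeConjecture
import Literature.AlgebraicGeometry.ComplexMultiplication.SimpleIffPrimitiveCMType
import HarnessLib

/-!
# Abelian CM fields of degree `16` whose Galois automorphisms all square to `1` or to complex conjugation —
# multiquadratic CM fields `ℚ(√d₁, √d₂, √d₃, √−m)` and (cyclic quartic CM)·(real biquadratic) fields:
# every simple CM abelian eightfold is nondegenerate, and the Hodge conjecture holds for all its powers

COR-CM (cell `pub-hodgecm2`), binder seat b04 (gen 15), count-neutral claim ABELIAN-2POWER-CLASSIF, part IIc; the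
number-field dress of parts IIa/IIb (`CorCM/AbelianSixteenStabilisers`, `…B`: for `G` commutative of order `16` with
all squares in `{1, ρ}`, a CM type equidistributed over an odd character has a stabiliser `v ≠ 1`) combined with
part Ia (`ThinKernel.not_isPrimitive_of_forall_mem_iff`) and gen 12's criterion
(`AbelianTwoPower.isNondegenerate_iff_forall_not_equidistributed`).  KERNEL ONLY: theorems; no definition, no named
fact, no `sorry`.  `HC_CM` is neither used nor claimed.

* **`isNondegenerate_of_isPrimitive_of_sq_eq_one_or_conj`** — `K` CM, Galois over `ℚ` with ABELIAN Galois group of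
  order `16`, every `g ∈ Gal(K/ℚ)` with `g² = 1` or `g² = c` (complex conjugation): every PRIMITIVE CM type of `K`
  is NONDEGENERATE (Kubota rank `9`).  The two Galois types are `(ℤ/2)⁴` (all `g² = 1`:
  **`isNondegenerate_of_isPrimitive_of_sq_eq_one`**, the MULTIQUADRATIC CM fields of degree `16`, e.g.
  `ℚ(√−1, √2, √3, √5)`, `ℚ(√−7, √2, √5, √13)`) and `ℤ/4 × (ℤ/2)²` with `c` a square (`K = K₁·L`, `K₁` a cyclic
  quartic CM field such as `ℚ(ζ₅)` or `ℚ(ζ₁₆ − ζ₁₆⁻¹)`, `L` a real biquadratic field with `K₁ ∩ L = ℚ`, e.g.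
  `ℚ(ζ₅, √2, √3)`).
* §2 realisations with `A` SIMPLE (⟺ `Φ` primitive, Shimura §8.2 Prop. 26): `Bᵐ(Aᴺ) ⊗ ℂ = Dᵐ(Aᴺ) ⊗ ℂ` on all
  powers and **the Hodge conjecture for `A` and every power `Aᴺ` — UNCONDITIONALLY** — for every simple abelian
  EIGHTFOLD with complex multiplication by such a field (`hodgeConjectureFor_pow_of_isSimple_of_sq_eq_one_or_conj`,
  `hodgeConjectureFor_pow_of_isSimple_multiquadratic`).

Remarks. (1) Simple CM eightfolds with CM by these fields exist: `(ℤ/2)⁴` has `128` primitive types (e.g. the type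
read by the cubic Boolean function `x₁x₂x₃` on `Gal(K/k)` for any imaginary quadratic `k ⊆ K`), `ℤ/4 × (ℤ/2)²`
(`c` square) has `192` (offline census of this seat).  (2) Although a multiquadratic CM field of degree `16` contains
`8` imaginary quadratic subfields, NO simple CM eightfold with CM by it is of Weil type over any of them: the
`F₂³`-lemma of part IIa says a `(4,4)`-type over `k` is induced.  (3) Sharp in the degree: the multiquadratic CM
fields of degree `32` carry `26880` primitive DEGENERATE types (rank `11`), and `ℤ/4 × (ℤ/2)³` with `c` a square
`12544`; degree `8` (all octic Galois fields) is gen 13's `GaloisOctic.isNondegenerate_of_isPrimitive_of_isGalois_eight`.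

## References

* [Kubota1965] T. Kubota, *On the field extension by complex multiplication*, Trans. AMS 118 (1965), §4 Lemma 2.
* [Shimura1998] G. Shimura, *Abelian Varieties with Complex Multiplication and Modular Functions*, §8.2 Prop. 26,
  §18.2 Lemma.
* [Gordon1999HodgeAVSurvey] B. B. Gordon, *A survey of the Hodge conjecture for abelian varieties*, 5.13, Thm. 6.4,
  §9.4.
* [Dodson1984] B. Dodson, *The structure of Galois groups of CM-fields*, Trans. AMS 283 (1984), §3.1.1, §5.2.
-/

noncomputable section

open CategoryTheory CategoryTheory.Limits NumberField

namespace Summit.HodgeConjecture.CorCM.AbelianSixteen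

open Literature.NumberTheory.ComplexMultiplication
open Literature.AlgebraicGeometry.Motives (AbelianVariety CMType)
open Literature.AlgebraicGeometry.HodgeTheory
open Literature.AlgebraicGeometry.ComplexMultiplication (IsCMTypeRealisation isSimple_iff_isPrimitive)
open Literature.AlgebraicGeometry.VanGeemen1994 (hodgeClassSpan)
open Literature.Barriers.HodgeConjecture (divisorClassesSpan)
open Literature.AlgebraicGeometry.Pohlmann1968
open Summit.HodgeConjecture.CorCM.AbelianTwoPower (isNondegenerate_iff_forall_not_equidistributed)
open Summit.HodgeConjecture.CorCM.GaloisOctic (embOf_complexConj_mul_mem_iff complexConj_mul_self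
  complexConj_restrictScalars_ne_one)
open Summit.HodgeConjecture.CorCM.ThinKernel (not_isPrimitive_of_forall_mem_iff complexConj_restrictScalars_apply)

/-! ## §1 Primitive types are nondegenerate -/

section Field

variable {K : Type} [Field K] [NumberField K] [IsCMField K] [IsGalois ℚ K] {Φ : CMType K}

/-- **Degree `16`, abelian, all squares `1` or `c` ⟹ primitive CM types are nondegenerate.**  Let `K` be a CM field,
Galois over `ℚ` with ABELIAN Galois group of order `[K:ℚ] = 16`, such that every Galois automorphism `g` satisfies
`g² = 1` or `g² = c` (complex conjugation) — Galois type `(ℤ/2)⁴`, or `ℤ/4 × (ℤ/2)²` with `c` a square.  Then every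
PRIMITIVE CM type of `K` is NONDEGENERATE: a degenerate type is equidistributed over an odd character (gen 12's
criterion), hence `{g | σ_g ∈ Φ}` has a stabiliser `v ≠ 1` (`exists_stabiliser_sixteen`), contradicting primitivity
(`ThinKernel.not_isPrimitive_of_forall_mem_iff`). [cite: Kubota1965, §4 Lemma 2] [cite: Shimura1998, §8.2 Prop. 26] -/
theorem isNondegenerate_of_isPrimitive_of_sq_eq_one_or_conj (hcomm : ∀ g h : K ≃ₐ[ℚ] K, g * h = h * g)
    (hK : Module.finrank ℚ K = 16)
    (hsq : ∀ g : K ≃ₐ[ℚ] K, g * g = 1 ∨ g * g = (IsCMField.complexConj K).restrictScalars ℚ)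
    (φ₀ : K →+* ℂ) (hprim : IsPrimitive (ℂ ≃+* ℂ) Φ.1 φ₀) : IsNondegenerate Φ := by
  classical
  letI : CommGroup (K ≃ₐ[ℚ] K) := { (inferInstance : Group (K ≃ₐ[ℚ] K)) with mul_comm := hcomm }
  set c : K ≃ₐ[ℚ] K := (IsCMField.complexConj K).restrictScalars ℚ with hc_def
  have hK' : Module.finrank ℚ K = 2 ^ (3 + 1) := by rw [hK]; norm_num
  by_contra hdeg
  have hcrit := (isNondegenerate_iff_forall_not_equidistributed hcomm hK' Φ φ₀ c
    (complexConj_restrictScalars_apply φ₀)).not.1 hdeg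
  push Not at hcrit
  obtain ⟨χ, hχ, hE⟩ := hcrit
  set T : Finset (K ≃ₐ[ℚ] K) := Finset.univ.filter fun g' : K ≃ₐ[ℚ] K => embOf φ₀ g' ∈ Φ.1 with hT_def
  have hmemT : ∀ g, g ∈ T ↔ embOf φ₀ g ∈ Φ.1 := fun g => by simp [hT_def]
  have hT : ∀ g : K ≃ₐ[ℚ] K, c * g ∈ T ↔ g ∉ T := fun g => by
    rw [hmemT, hmemT]; exact embOf_complexConj_mul_mem_iff Φ φ₀ g
  have hcard : Fintype.card (K ≃ₐ[ℚ] K) = 16 := by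
    rw [Fintype.card_congr (Equiv.ofBijective (embOf φ₀) (embOf_bijective φ₀)), NumberField.Embeddings.card, hK]
  obtain ⟨v, hv1, hv⟩ := exists_stabiliser_sixteen hT complexConj_mul_self hcard hsq χ hχ hE
  refine not_isPrimitive_of_forall_mem_iff Φ φ₀ hv1 (fun w => ?_) hprim
  rw [← hmemT, ← hmemT]
  exact hv w

/-- Rank form: Kubota rank `9`. [cite: Kubota1965, §4 Lemma 2] -/
theorem cmTypeRank_eq_nine_of_isPrimitive_of_sq_eq_one_or_conj (hcomm : ∀ g h : K ≃ₐ[ℚ] K, g * h = h * g)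
    (hK : Module.finrank ℚ K = 16)
    (hsq : ∀ g : K ≃ₐ[ℚ] K, g * g = 1 ∨ g * g = (IsCMField.complexConj K).restrictScalars ℚ)
    (φ₀ : K →+* ℂ) (hprim : IsPrimitive (ℂ ≃+* ℂ) Φ.1 φ₀) : cmTypeRank Φ = 9 := by
  have h := (isNondegenerate_iff Φ).1 (isNondegenerate_of_isPrimitive_of_sq_eq_one_or_conj hcomm hK hsq φ₀ hprim)
  rw [hK] at h
  exact h

/-- **MULTIQUADRATIC CM fields of degree `16`: every primitive CM type is nondegenerate.**  If `[K:ℚ] = 16` and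
every Galois automorphism of the CM field `K` is an involution (`Gal(K/ℚ) ≅ (ℤ/2)⁴`:
`K = ℚ(√d₁, √d₂, √d₃, √−m)`; a group of exponent `2` is commutative, tree
`GaloisRepresentations.MultiQuadratic.mul_comm'` — re-derived inline to keep the import cone small), every primitive
CM type has Kubota rank `9`.  (The `8` imaginary quadratic subfields carry no PRIMITIVE Weil type: a `4`-subset of
`F₂³` is an affine plane or an affine frame.) [cite: Kubota1965, §4 Lemma 2] [cite: Shimura1998, §8.2 Prop. 26] -/
theorem isNondegenerate_of_isPrimitive_of_sq_eq_one (hK : Module.finrank ℚ K = 16)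
    (hsq : ∀ g : K ≃ₐ[ℚ] K, g * g = 1) (φ₀ : K →+* ℂ) (hprim : IsPrimitive (ℂ ≃+* ℂ) Φ.1 φ₀) :
    IsNondegenerate Φ := by
  have hinv : ∀ x : K ≃ₐ[ℚ] K, x⁻¹ = x := fun x => inv_eq_of_mul_eq_one_right (hsq x)
  have hcomm : ∀ g h : K ≃ₐ[ℚ] K, g * h = h * g := fun g h =>
    calc g * h = (g * h)⁻¹ := (hinv _).symm
      _ = h⁻¹ * g⁻¹ := mul_inv_rev g h
      _ = h * g := by rw [hinv, hinv]
  exact isNondegenerate_of_isPrimitive_of_sq_eq_one_or_conj hcomm hK (fun g => Or.inl (hsq g)) φ₀ hprim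

end Field

/-! ## §2 Realisations: the Hodge conjecture for all powers of the simple CM abelian eightfolds of these fields -/

section Geometry

variable {K : Type} [Field K] [NumberField K] [IsCMField K] [IsGalois ℚ K] {Φ : CMType K}
variable {A : AbelianVariety ℂ} {ι : 𝓞 K →+* End A} {θ : K →+* Module.End ℂ (complexBetti A.X 1)}

/-- **A SIMPLE abelian eightfold with CM by such a field realises a nondegenerate type** (`A` simple ⟺ `Φ`
primitive). [cite: Shimura1998, §8.2 Prop. 26] [cite: Kubota1965, §4 Lemma 2] -/
theorem isNondegenerate_of_isSimple_of_sq_eq_one_or_conj (hcomm : ∀ g h : K ≃ₐ[ℚ] K, g * h = h * g)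
    (hK : Module.finrank ℚ K = 16)
    (hsq : ∀ g : K ≃ₐ[ℚ] K, g * g = 1 ∨ g * g = (IsCMField.complexConj K).restrictScalars ℚ)
    (hA : IsCMTypeRealisation Φ A ι θ) (hs : A.IsSimple) : IsNondegenerate Φ := by
  obtain ⟨φ₀⟩ := (inferInstance : Nonempty (K →+* ℂ))
  exact isNondegenerate_of_isPrimitive_of_sq_eq_one_or_conj hcomm hK hsq φ₀ ((isSimple_iff_isPrimitive hA φ₀).1 hs)

/-- **`Bᵐ(Aᴺ) ⊗ ℂ = Dᵐ(Aᴺ) ⊗ ℂ` on every power** (`Hdg = Div` on all powers, Gordon 5.13 (i) / Hazama 6.4).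
[cite: Gordon1999HodgeAVSurvey, 5.13 (i) and Thm. 6.4] -/
theorem hodgeClassSpan_pow_eq_divisorClassesSpan_of_isSimple_of_sq_eq_one_or_conj
    (hcomm : ∀ g h : K ≃ₐ[ℚ] K, g * h = h * g) (hK : Module.finrank ℚ K = 16)
    (hsq : ∀ g : K ≃ₐ[ℚ] K, g * g = 1 ∨ g * g = (IsCMField.complexConj K).restrictScalars ℚ)
    (hA : IsCMTypeRealisation Φ A ι θ) (hs : A.IsSimple) (N m : ℕ) :
    hodgeClassSpan (⨁ fun _ : Fin N => A).dim (⨁ fun _ : Fin N => A).X m =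
      divisorClassesSpan (⨁ fun _ : Fin N => A).X (⨁ fun _ : Fin N => A).dim m :=
  (isNondegenerate_of_isSimple_of_sq_eq_one_or_conj hcomm hK hsq hA hs).hodgeClassSpan_pow_eq_divisorClassesSpan
    hA N m

/-- **No power carries an exceptional Hodge class**: every rational `(m,m)`-class on `Aᴺ` is a polynomial in divisor
classes. [cite: Gordon1999HodgeAVSurvey, 5.13 (i) and Thm. 6.4] -/
theorem mem_divisorClassesSpan_pow_of_isSimple_of_sq_eq_one_or_conj (hcomm : ∀ g h : K ≃ₐ[ℚ] K, g * h = h * g)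
    (hK : Module.finrank ℚ K = 16)
    (hsq : ∀ g : K ≃ₐ[ℚ] K, g * g = 1 ∨ g * g = (IsCMField.complexConj K).restrictScalars ℚ)
    (hA : IsCMTypeRealisation Φ A ι θ) (hs : A.IsSimple) (N m : ℕ)
    {x : complexBetti (⨁ fun _ : Fin N => A).X (2 * m)} (hxQ : IsRationalClass x)
    (hxH : IsOfHodgeType (⨁ fun _ : Fin N => A).dim (⨁ fun _ : Fin N => A).X (2 * m) m m x) :
    x ∈ divisorClassesSpan (⨁ fun _ : Fin N => A).X (⨁ fun _ : Fin N => A).dim m :=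
  (isNondegenerate_of_isSimple_of_sq_eq_one_or_conj hcomm hK hsq hA hs).mem_divisorClassesSpan_pow hA N m hxQ hxH

/-- **THE HODGE CONJECTURE FOR EVERY POWER `Aᴺ` OF EVERY SIMPLE ABELIAN EIGHTFOLD WITH COMPLEX MULTIPLICATION BY AN
ABELIAN CM FIELD OF DEGREE `16` ALL OF WHOSE GALOIS AUTOMORPHISMS SQUARE TO `1` OR TO COMPLEX CONJUGATION —
UNCONDITIONALLY** (no named fact).  Galois types `(ℤ/2)⁴` and `ℤ/4 × (ℤ/2)²` with `c` a square: e.g.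
`ℚ(√−1, √2, √3, √5)`, `ℚ(ζ₅, √2, √3)`. [cite: Gordon1999HodgeAVSurvey, 5.13 (i) and Thm. 6.4] [cite: Kubota1965, §4 Lemma 2] -/
theorem hodgeConjectureFor_pow_of_isSimple_of_sq_eq_one_or_conj (hcomm : ∀ g h : K ≃ₐ[ℚ] K, g * h = h * g)
    (hK : Module.finrank ℚ K = 16)
    (hsq : ∀ g : K ≃ₐ[ℚ] K, g * g = 1 ∨ g * g = (IsCMField.complexConj K).restrictScalars ℚ)
    (hA : IsCMTypeRealisation Φ A ι θ) (hs : A.IsSimple) (N : ℕ) :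
    HodgeConjectureFor (⨁ fun _ : Fin N => A).dim (⨁ fun _ : Fin N => A).X :=
  (isNondegenerate_of_isSimple_of_sq_eq_one_or_conj hcomm hK hsq hA hs).hodgeConjectureFor_pow hA N

/-- **The Hodge conjecture for the simple eightfold itself.** [cite: Gordon1999HodgeAVSurvey, 5.13 (i)] -/
theorem hodgeConjectureFor_of_isSimple_of_sq_eq_one_or_conj (hcomm : ∀ g h : K ≃ₐ[ℚ] K, g * h = h * g)
    (hK : Module.finrank ℚ K = 16)
    (hsq : ∀ g : K ≃ₐ[ℚ] K, g * g = 1 ∨ g * g = (IsCMField.complexConj K).restrictScalars ℚ)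
    (hA : IsCMTypeRealisation Φ A ι θ) (hs : A.IsSimple) : HodgeConjectureFor A.dim A.X :=
  (isNondegenerate_of_isSimple_of_sq_eq_one_or_conj hcomm hK hsq hA hs).hodgeConjectureFor hA

/-- **THE HODGE CONJECTURE FOR EVERY POWER OF EVERY SIMPLE ABELIAN EIGHTFOLD WITH COMPLEX MULTIPLICATION BY A
MULTIQUADRATIC CM FIELD OF DEGREE `16`** (`ℚ(√d₁, √d₂, √d₃, √−m)`; every Galois automorphism an involution) —
UNCONDITIONALLY. [cite: Gordon1999HodgeAVSurvey, 5.13 (i) and Thm. 6.4] [cite: Kubota1965, §4 Lemma 2] -/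
theorem hodgeConjectureFor_pow_of_isSimple_multiquadratic (hK : Module.finrank ℚ K = 16)
    (hsq : ∀ g : K ≃ₐ[ℚ] K, g * g = 1) (hA : IsCMTypeRealisation Φ A ι θ) (hs : A.IsSimple) (N : ℕ) :
    HodgeConjectureFor (⨁ fun _ : Fin N => A).dim (⨁ fun _ : Fin N => A).X := by
  obtain ⟨φ₀⟩ := (inferInstance : Nonempty (K →+* ℂ))
  exact (isNondegenerate_of_isPrimitive_of_sq_eq_one hK hsq φ₀
    ((isSimple_iff_isPrimitive hA φ₀).1 hs)).hodgeConjectureFor_pow hA N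

/-- The Hodge conjecture for every simple abelian eightfold with CM by a multiquadratic CM field of degree `16`.
[cite: Gordon1999HodgeAVSurvey, 5.13 (i)] -/
theorem hodgeConjectureFor_of_isSimple_multiquadratic (hK : Module.finrank ℚ K = 16)
    (hsq : ∀ g : K ≃ₐ[ℚ] K, g * g = 1) (hA : IsCMTypeRealisation Φ A ι θ) (hs : A.IsSimple) :
    HodgeConjectureFor A.dim A.X := by
  obtain ⟨φ₀⟩ := (inferInstance : Nonempty (K →+* ℂ))
  exact (isNondegenerate_of_isPrimitive_of_sq_eq_one hK hsq φ₀
    ((isSimple_iff_isPrimitive hA φ₀).1 hs)).hodgeConjectureFor hA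

end Geometry

end Summit.HodgeConjecture.CorCM.AbelianSixteen

end
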